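import Summits.AnomalousDissipation.AnomalousDissipation.Theorems.BaireTransferDenseLoudDesignerForcesErgodicPeriodicOrbitA
import Literature.Analysis.FluidPDE.TorusClassicalNSModeDuhamel
import Literature.Analysis.FluidPDE.TorusForceBookkeeping
import Literature.Analysis.FluidPDE.StokesTorusProofs

/-!
# Classical Navier–Stokes solutions are mild: the weak Duhamel identity in `H`
# (line `ergodic-budget-selection-closing`, crux `BaireTransfer.DenseLoudDesignerForces`,
# stmt-AnomalousDissipation-1143) — tools stub S5 of block N-R

Sorry-free file over the landed vocabulary `…ErgodicLine.lean` (`Hsp = Torus.energySpace (Fin 3)`, `rep`) and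
`…ErgodicPeriodicOrbitA.lean` (`stateOf`, `rep_stateOf`), the landed modewise Duhamel formula
`Torus.IsClassicalNSSolutionOn.integral_inner_eq_exp_mul_add_integral`
(`Literature/Analysis/FluidPDE/TorusClassicalNSModeDuhamel.lean`) and the Stokes modes
(`Literature/Analysis/FluidPDE/StokesTorusProofs.lean`).  Block N-R of the line identifies the classical NS
trajectories of an NS phase with the MILD solutions `y(t) = T(νt) y₀ + ∫₀ᵗ T(ν(t − s)) P(F − (u·∇)u) ds` in the energy
space; this file is the identification in weak form:

* `integral_inner_rep_eq_inner`, `inner_stateOf_left` — pairing a field with (a representative of) a state of `H`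
  is the `L²` inner product of its class with the state;
* `stub_classicalWeakDuhamelTools` (the REGISTERED tools stub S5, proved) — for a Hilbert basis `b` of `Hsp` made of
  Stokes modes (`(b i : L²) = stokesModeL2 k a c`, `m i = 4π²|k|²`; the mode clause of `exists_hilbertBasis_stokes`)
  and a family `T t` of self-adjoint contractions, strongly continuous, with `T t (b i) = e^{-t m_i} b i` (the Stokes
  semigroup of S1, `stub_stokesSemigroupFrameTools`), every classical solution `(u, p)` of NS_ν(F) with mean-zero
  slices on `[a₀, a₀ + τ'] × T³` satisfies, for `t ∈ [a₀, a₀ + τ']` and every `h ∈ Hsp`,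
  `⟪[u(t)], h⟫ = ⟪T(ν(t − a₀))[u(a₀)], h⟫ + ∫_{a₀}^t ∫ ⟪F − (u(s)·∇)u(s), rep (T(ν(t − s)) h)⟫ dx ds`.

Proof: for `h = b i` this is the modewise formula (the mode `φ = stokesMode k a c` is smooth, divergence free,
`Δφ = −m_i φ`; `rep (b i) = φ` a.e.; `T` is moved onto `b i` by self-adjointness; the antisymmetry
`∫⟪(u·∇)u, φ⟫ = −∫⟪u, (u·∇)φ⟫`); both sides are continuous linear functionals of `h` (the Duhamel term is
`h ↦ ∫ ⟪g(s), T(ν(t − s)) h⟫_{L²} ds` with `s ↦ g(s) = [F − (u(s)·∇)u(s)] ∈ L²` continuous, bounded by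
`sup ‖g‖ · |t − a₀| · ‖h‖`), and two continuous linear functionals agreeing on a Hilbert basis agree
(`HilbertBasis.dense_span`, `ContinuousLinearMap.ext_on`).

References: P. Constantin, C. Foias, *Navier–Stokes Equations* (Chicago 1988), Ch. 5 (5.9)–(5.10) (the mild form);
J. C. Robinson, J. L. Rodrigo, W. Sadowski, *The Three-Dimensional Navier–Stokes Equations* (CUP 2016), (3.9).
Nothing is asserted; no definition is added.
-/

-- `Summit.<Summit>.<Problem>` is the tree's mandated summit-side namespace (CONVENTIONS §2); for this
-- single-conjunct summit the two coincide, so the duplicate is deliberate.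
set_option linter.dupNamespace false

noncomputable section

open Set Function MeasureTheory Filter
open scoped InnerProductSpace RealInnerProductSpace

namespace Summit.AnomalousDissipation.AnomalousDissipation.Theorems.DenseLoudDesignerForces.Ergodic

open Literature.Analysis.FunctionSpaces Literature.Analysis.FunctionSpaces.Torus
open Literature.Analysis.FluidPDE Literature.Analysis.FluidPDE.Torus

/-! ## Pairing fields with states of `H` -/

/-- Pairing a square-integrable field `g` with a representative of a state `y ∈ H` is the `L²` inner product of the
class of `g` with `y` (`L2.inner_def`; the integral only sees a.e.-classes). [folklore] -/
theorem integral_inner_rep_eq_inner {g : (UnitAddTorus (Fin 3)) → (EuclideanSpace ℝ (Fin 3))}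
    (hg : MemLp g 2 (volume : Measure (UnitAddTorus (Fin 3)))) (y : Hsp) :
    ∫ x, ⟪g x, rep y x⟫_ℝ =
      ⟪hg.toLp g, ((y : Hsp) : Lp (EuclideanSpace ℝ (Fin 3)) 2 (volume : Measure (UnitAddTorus (Fin 3))))⟫_ℝ := by
  rw [MeasureTheory.L2.inner_def]
  refine integral_congr_ae ?_
  filter_upwards [hg.coeFn_toLp] with x hx
  show _ = ⟪(hg.toLp g) x, rep y x⟫_ℝ
  rw [hx]

/-- The state of an honest (smooth, divergence-free, mean-zero) field `v` pairs with a state `y ∈ H` as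
`⟪[v], y⟫ = ∫ ⟪v, rep y⟫` (`rep [v] = v` a.e., `rep_stateOf`). [folklore] -/
theorem inner_stateOf_left {v : (UnitAddTorus (Fin 3)) → (EuclideanSpace ℝ (Fin 3))} (hv : IsSmooth v)
    (hd : IsDivFree v) (hm : HasZeroMean v) (y : Hsp) : ⟪stateOf v, y⟫_ℝ = ∫ x, ⟪v x, rep y x⟫_ℝ := by
  rw [Submodule.coe_inner, MeasureTheory.L2.inner_def]
  refine integral_congr_ae ?_
  filter_upwards [rep_stateOf hv hd hm] with x hx
  show ⟪rep (stateOf v) x, rep y x⟫_ℝ = _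
  rw [hx]

/-! ## The weak Duhamel identity -/

/-- **Tools stub S5 — CLASSICAL SOLUTIONS ARE MILD: the weak Duhamel identity in the energy space (block N-R).**
On a Hilbert basis `b` of `Hsp` made of Stokes modes (`(b i : L²) = stokesModeL2 k a c`, `m i = stokesEigenvalue k`;
the mode clause of `exists_hilbertBasis_stokes`) with a strongly continuous family `T t` of self-adjoint
contractions acting diagonally, `T t (b i) = e^{-t m_i} b i` (`t ≥ 0`; the Stokes semigroup `e^{-tA}` of S1), every
classical solution `(u, p)` of NS_ν(F) (steady smooth force `F`, `ν > 0`) with zero-mean slices on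
`[a₀, a₀ + τ'] × T³` satisfies, for all `t ∈ [a₀, a₀ + τ']` and all test states `h ∈ Hsp`,
`⟪[u(t)], h⟫ = ⟪T(ν(t − a₀))[u(a₀)], h⟫ + ∫_{a₀}^t ∫_{T³} ⟪F − (u(s)·∇)u(s), rep (T(ν(t − s)) h)⟫ dx ds`
(`[v] = stateOf v`) — the state curve is the mild solution
`[u(t)] = e^{-ν(t−a₀)A}[u(a₀)] + ∫_{a₀}^t e^{-ν(t−s)A} P(F − (u·∇)u) ds` tested against `h`.  For `h = b i` this is
the modewise Duhamel formula `IsClassicalNSSolutionOn.integral_inner_eq_exp_mul_add_integral`; both sides are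
continuous linear functionals of `h`, and such functionals agreeing on a Hilbert basis agree (Constantin–Foias 1988,
Ch. 5 (5.9)–(5.10); Robinson–Rodrigo–Sadowski 2016, (3.9)). [cite: ConstantinFoiasNSE1988, Ch. 5 (5.9)–(5.10)] -/
theorem stub_classicalWeakDuhamelTools (ι : Type) (b : HilbertBasis ι ℝ Hsp) (m : ι → ℝ)
    (hb : ∀ i, ∃ (k : Fin 3 → ℤ) (a : EuclideanSpace ℝ (Fin 3)) (c : Bool), k ≠ 0 ∧ a ≠ 0 ∧ ⟪latticeVec k, a⟫_ℝ = 0 ∧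
      ((b i : Hsp) : Lp (EuclideanSpace ℝ (Fin 3)) 2 (volume : Measure (UnitAddTorus (Fin 3)))) = stokesModeL2 k a c ∧
      m i = stokesEigenvalue k)
    (T : ℝ → Hsp →L[ℝ] Hsp) (hT : ∀ t i, 0 ≤ t → T t (b i) = Real.exp (-(t * m i)) • b i) (hTnorm : ∀ t, 0 ≤ t → ‖T t‖ ≤ 1)
    (hTsa : ∀ t, 0 ≤ t → IsSelfAdjoint (T t)) (hTc : ∀ y : Hsp, Continuous fun t : ℝ => T t y)
    {ν : ℝ} (hν : 0 < ν) {F : (UnitAddTorus (Fin 3)) → (EuclideanSpace ℝ (Fin 3))} (hF : IsSmooth F) {a₀ τ' : ℝ} (hτ' : 0 < τ')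
    {u : ℝ → (UnitAddTorus (Fin 3)) → (EuclideanSpace ℝ (Fin 3))} {p : ℝ → (UnitAddTorus (Fin 3)) → ℝ}
    (hsol : IsClassicalNSSolutionOn (Icc a₀ (a₀ + τ')) ν (fun _ => F) u p) (hmean : ∀ t ∈ Icc a₀ (a₀ + τ'), HasZeroMean (u t)) :
    ∀ t ∈ Icc a₀ (a₀ + τ'), ∀ h : Hsp,
      ⟪stateOf (u t), h⟫_ℝ = ⟪T (ν * (t - a₀)) (stateOf (u a₀)), h⟫_ℝ +
        ∫ s in a₀..t, ∫ x, ⟪F x - convect (u s) (u s) x, rep (T (ν * (t - s)) h) x⟫_ℝ := by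
  intro t ht h
  have hU : UniqueDiffOn ℝ (Icc a₀ (a₀ + τ')) := uniqueDiffOn_Icc (by linarith)
  have hu : IsSmoothSpaceTimeOn (Icc a₀ (a₀ + τ')) u := hsol.smooth_velocity
  have hus : ∀ s ∈ Icc a₀ (a₀ + τ'), IsSmooth (u s) := fun s hs => hu.isSmooth_slice hs
  have hat : a₀ ≤ t := ht.1
  have ha₀ : a₀ ∈ Icc a₀ (a₀ + τ') := ⟨le_rfl, by linarith⟩
  have hsub : Icc a₀ t ⊆ Icc a₀ (a₀ + τ') := Icc_subset_Icc_right ht.2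
  -- the smooth source `G(s) = F − (u(s)·∇)u(s)` and its continuous `L²` lift `gL`
  have hG : IsSmoothSpaceTimeOn (Icc a₀ (a₀ + τ')) (fun s x => F x - convect (u s) (u s) x) :=
    (isSmoothSpaceTimeOn_const hF _).sub (hu.convect hu hU)
  have hGc : Torus.ContinuousInLpOn (Icc a₀ (a₀ + τ')) 2 (fun s x => F x - convect (u s) (u s) x) :=
    hG.continuousInLpOn 2
  obtain ⟨gL, hgLc, hgL⟩ := hGc.exists_continuousOn_toLp
  have hψ : ∀ s ∈ Icc a₀ (a₀ + τ'), ∀ y : Hsp, ∫ x, ⟪F x - convect (u s) (u s) x, rep y x⟫_ℝ =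
      ⟪gL s, ((y : Hsp) : Lp (EuclideanSpace ℝ (Fin 3)) 2 (volume : Measure (UnitAddTorus (Fin 3))))⟫_ℝ := by
    intro s hs y
    rw [hgL s hs]
    exact integral_inner_rep_eq_inner (hGc.1 s hs) y
  -- a uniform bound `‖gL s‖ ≤ M` on the compact time interval
  obtain ⟨M₀, hM₀⟩ := isCompact_Icc.exists_bound_of_continuousOn hgLc
  obtain ⟨M, hM0, hgM⟩ : ∃ M : ℝ, 0 ≤ M ∧ ∀ s ∈ Icc a₀ (a₀ + τ'), ‖gL s‖ ≤ M :=
    ⟨max M₀ 0, le_max_right _ _, fun s hs => (hM₀ s hs).trans (le_max_left _ _)⟩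
  -- the Duhamel term as a continuous linear functional `Φ` of the test state
  have hTc' : ∀ y : Hsp, Continuous fun s : ℝ =>
      ((T (ν * (t - s)) y : Hsp) : Lp (EuclideanSpace ℝ (Fin 3)) 2 (volume : Measure (UnitAddTorus (Fin 3)))) :=
    fun y => continuous_subtype_val.comp ((hTc y).comp (continuous_const.mul (continuous_const.sub continuous_id)))
  have hii : ∀ y : Hsp, IntervalIntegrable (fun s => ⟪gL s,
      ((T (ν * (t - s)) y : Hsp) : Lp (EuclideanSpace ℝ (Fin 3)) 2 (volume : Measure (UnitAddTorus (Fin 3))))⟫_ℝ)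
      volume a₀ t := by
    intro y
    refine ContinuousOn.intervalIntegrable ?_
    rw [uIcc_of_le hat]
    exact (hgLc.mono hsub).inner (hTc' y).continuousOn
  have hbd : ∀ y : Hsp, ‖∫ s in a₀..t, ⟪gL s,
      ((T (ν * (t - s)) y : Hsp) : Lp (EuclideanSpace ℝ (Fin 3)) 2 (volume : Measure (UnitAddTorus (Fin 3))))⟫_ℝ‖ ≤
      M * |t - a₀| * ‖y‖ := by
    intro y
    have h1 : ‖∫ s in a₀..t, ⟪gL s,
        ((T (ν * (t - s)) y : Hsp) : Lp (EuclideanSpace ℝ (Fin 3)) 2 (volume : Measure (UnitAddTorus (Fin 3))))⟫_ℝ‖ ≤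
        M * ‖y‖ * |t - a₀| := by
      refine intervalIntegral.norm_integral_le_of_norm_le_const fun s hs => ?_
      rw [uIoc_of_le hat] at hs
      have hr : 0 ≤ ν * (t - s) := mul_nonneg hν.le (by linarith [hs.2])
      calc ‖⟪gL s, ((T (ν * (t - s)) y : Hsp) : Lp (EuclideanSpace ℝ (Fin 3)) 2 (volume : Measure (UnitAddTorus (Fin 3))))⟫_ℝ‖
          ≤ ‖gL s‖ * ‖((T (ν * (t - s)) y : Hsp) : Lp (EuclideanSpace ℝ (Fin 3)) 2 (volume : Measure (UnitAddTorus (Fin 3))))‖ :=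
            norm_inner_le_norm _ _
        _ ≤ M * ‖y‖ := by
            refine mul_le_mul (hgM s ⟨hs.1.le, hs.2.trans ht.2⟩) ?_ (norm_nonneg _) hM0
            rw [← Submodule.coe_norm]
            calc ‖T (ν * (t - s)) y‖ ≤ ‖T (ν * (t - s))‖ * ‖y‖ := (T _).le_opNorm y
              _ ≤ 1 * ‖y‖ := by gcongr; exact hTnorm _ hr
              _ = ‖y‖ := one_mul _
    calc _ ≤ M * ‖y‖ * |t - a₀| := h1
      _ = M * |t - a₀| * ‖y‖ := by ring
  obtain ⟨Φ, hΦ⟩ : ∃ Φ : Hsp →L[ℝ] ℝ, ∀ y : Hsp, Φ y = ∫ s in a₀..t, ⟪gL s,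
      ((T (ν * (t - s)) y : Hsp) : Lp (EuclideanSpace ℝ (Fin 3)) 2 (volume : Measure (UnitAddTorus (Fin 3))))⟫_ℝ :=
    ⟨LinearMap.mkContinuous
      { toFun := fun y => ∫ s in a₀..t, ⟪gL s,
          ((T (ν * (t - s)) y : Hsp) : Lp (EuclideanSpace ℝ (Fin 3)) 2 (volume : Measure (UnitAddTorus (Fin 3))))⟫_ℝ
        map_add' := fun y y' => by
          simp only [map_add, Submodule.coe_add, inner_add_right]
          exact intervalIntegral.integral_add (hii y) (hii y')
        map_smul' := fun r y => by
          simp only [map_smul, Submodule.coe_smul, real_inner_smul_right, RingHom.id_apply, smul_eq_mul]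
          exact intervalIntegral.integral_const_mul r _ } (M * |t - a₀|) hbd,
      fun y => rfl⟩
  -- the identity on the basis vectors: the modewise Duhamel formula
  have hbasis : ∀ i, ⟪stateOf (u t), b i⟫_ℝ = ⟪T (ν * (t - a₀)) (stateOf (u a₀)), b i⟫_ℝ + Φ (b i) := by
    intro i
    obtain ⟨k, a, c, -, -, hka, hbi, hmi⟩ := hb i
    have hφs : IsSmooth ⇑(stokesMode k a c) := isSmooth_stokesMode k a c
    have hφd : IsDivFree ⇑(stokesMode k a c) := isDivFree_stokesMode hka c
    have heig : ∀ x, laplacian ⇑(stokesMode k a c) x = -(stokesEigenvalue k • stokesMode k a c x) := fun x => by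
      rw [laplacian_stokesMode, neg_smul]
    have hrep : rep (b i) =ᵐ[volume] ⇑(stokesMode k a c) := by
      show (((b i : Hsp) : Lp (EuclideanSpace ℝ (Fin 3)) 2 (volume : Measure (UnitAddTorus (Fin 3)))) :
          (UnitAddTorus (Fin 3)) → (EuclideanSpace ℝ (Fin 3))) =ᵐ[volume] _
      rw [hbi]
      exact coeFn_stokesModeL2 k a c
    -- states pair with `b i` through the mode
    have hst : ∀ s ∈ Icc a₀ (a₀ + τ'), ⟪stateOf (u s), b i⟫_ℝ = ∫ x, ⟪u s x, stokesMode k a c x⟫_ℝ := by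
      intro s hs
      rw [inner_stateOf_left (hus s hs) (hsol.divFree s hs) (hmean s hs)]
      refine integral_congr_ae ?_
      filter_upwards [hrep] with x hx
      rw [hx]
    -- `T r` is moved onto `b i` by self-adjointness
    have hTi : ∀ r : ℝ, 0 ≤ r → ∀ y : Hsp, ⟪T r y, b i⟫_ℝ = Real.exp (-(r * m i)) * ⟪y, b i⟫_ℝ := by
      intro r hr y
      have hsym := (hTsa r hr).isSymmetric y (b i)
      simp only [ContinuousLinearMap.coe_coe] at hsym
      rw [hsym, hT r i hr]
      exact inner_smul_right (𝕜 := ℝ) (E := Hsp) y (b i) _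
    -- the source pairing along `b i`
    have hsrc : EqOn
        (fun s => ⟪gL s, ((T (ν * (t - s)) (b i) : Hsp) :
          Lp (EuclideanSpace ℝ (Fin 3)) 2 (volume : Measure (UnitAddTorus (Fin 3))))⟫_ℝ)
        (fun s => Real.exp (-(ν * stokesEigenvalue k * (t - s))) *
          ((∫ x, ⟪u s x, convect (u s) ⇑(stokesMode k a c) x⟫_ℝ) + ∫ x, ⟪F x, stokesMode k a c x⟫_ℝ))
        (uIcc a₀ t) := by
      intro s hs
      rw [uIcc_of_le hat] at hs
      have hs' : s ∈ Icc a₀ (a₀ + τ') := hsub hs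
      have hr : 0 ≤ ν * (t - s) := mul_nonneg hν.le (by linarith [hs.2])
      have h1 : ∫ x, ⟪F x - convect (u s) (u s) x, rep (b i) x⟫_ℝ =
          ∫ x, ⟪F x - convect (u s) (u s) x, stokesMode k a c x⟫_ℝ := by
        refine integral_congr_ae ?_
        filter_upwards [hrep] with x hx
        rw [hx]
      have iF : Integrable (fun x => ⟪F x, stokesMode k a c x⟫_ℝ) volume := (hF.inner hφs).integrable
      have iC : Integrable (fun x => ⟪convect (u s) (u s) x, stokesMode k a c x⟫_ℝ) volume :=
        (((hus s hs').convect (hus s hs')).inner hφs).integrable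
      have h2 : ∫ x, ⟪F x - convect (u s) (u s) x, stokesMode k a c x⟫_ℝ =
          (∫ x, ⟪F x, stokesMode k a c x⟫_ℝ) - ∫ x, ⟪convect (u s) (u s) x, stokesMode k a c x⟫_ℝ := by
        simp only [inner_sub_left]
        exact integral_sub iF iC
      show ⟪gL s, ((T (ν * (t - s)) (b i) : Hsp) :
          Lp (EuclideanSpace ℝ (Fin 3)) 2 (volume : Measure (UnitAddTorus (Fin 3))))⟫_ℝ = _
      rw [hT _ i hr, Submodule.coe_smul, real_inner_smul_right, ← hψ s hs' (b i), hmi, h1, h2,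
        integral_inner_convect_eq_neg (hus s hs') (hsol.divFree s hs') (hus s hs') hφs,
        show ν * (t - s) * stokesEigenvalue k = ν * stokesEigenvalue k * (t - s) by ring]
      ring
    have hD := hsol.integral_inner_eq_exp_mul_add_integral hφs hφd heig ht
    rw [hst t ht, hTi _ (mul_nonneg hν.le (by linarith)) (stateOf (u a₀)), hst a₀ ha₀, hΦ,
      intervalIntegral.integral_congr hsrc, hD, hmi,
      show ν * (t - a₀) * stokesEigenvalue k = ν * stokesEigenvalue k * (t - a₀) by ring]
  -- two continuous linear functionals agreeing on a Hilbert basis agree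
  have hdense : Dense (Submodule.span ℝ (Set.range b) : Set Hsp) :=
    Submodule.dense_iff_topologicalClosure_eq_top.2 b.dense_span
  have key : innerSL ℝ (stateOf (u t)) = innerSL ℝ (T (ν * (t - a₀)) (stateOf (u a₀))) + Φ := by
    refine ContinuousLinearMap.ext_on hdense ?_
    rintro _ ⟨i, rfl⟩
    simp only [_root_.add_apply, innerSL_apply_apply]
    exact hbasis i
  have hh := congrArg (fun f : Hsp →L[ℝ] ℝ => f h) key
  simp only [_root_.add_apply, innerSL_apply_apply] at hh
  rw [hh, hΦ h]
  congr 1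
  refine intervalIntegral.integral_congr fun s hs => ?_
  rw [uIcc_of_le hat] at hs
  exact (hψ s (hsub hs) _).symm

end Summit.AnomalousDissipation.AnomalousDissipation.Theorems.DenseLoudDesignerForces.Ergodic

end
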